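import Summits.QuantumFields.QCD.Theorems.HeatSlicedQuarksRobustYangMillsHandoverEmbeddedLevels
import Summits.QuantumFields.QCD.Theorems.HeatSlicedQuarksRobustYangMillsHandoverEmbedPackage
import Summits.QuantumFields.QCD.Theorems.HeatSlicedQuarksRobustYangMillsHandoverTransferOpPowEmbed
import Summits.QuantumFields.QCD.Theorems.HeatSlicedQuarksRobustYangMillsHandoverFermionSliceSqrt
import Summits.QuantumFields.QCD.Theorems.HeatSlicedQuarksRobustYangMillsHandoverTransferKernelRegular
import Summits.QuantumFields.QCD.Theorems.QuarksAsStableActionStableActionBridgeTransferLevelBounds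
import Literature.Analysis.OperatorTheory.HermitianKernelOperator
import Literature.Analysis.OperatorTheory.CompactPositiveTopLevel
import Literature.Analysis.OperatorTheory.SecondLevelGapDense
import Literature.Analysis.OperatorTheory.InvariantSubspaceRestriction
import Literature.Analysis.OperatorTheory.SpectralGapPowerDecay

/-!
# Exponential clustering of the QCD transfer matrix at the rate of its min–max gap
(crux `HeatSlicedQuarks.RobustYangMillsHandover`, item stmt-QuantumFields-8892, line `pin-the-infimum`; lead c14 assembly of
the spectral infrastructure M2, registered sub-goal `transfer_cluster`, `--supports stmt-QuantumFields-8892`)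

`Literature/MathematicalPhysics/QuantumFieldTheory/QCDTransferMatrix.lean` defines the levels
`λₙ = qcdTransferLevel N_f S β m n` of Lüscher's positive transfer matrix of lattice QCD with `r = 1` Wilson quarks by
the min–max recipe over the core of continuous gauge-invariant waves, WITHOUT operators, and the gap
`qcdTransferGap = log λ₀ − log λ₁`.  This file proves that this gap is an honest spectral gap in the direction the
line's dictionary stub consumes: the `n`-step transfer forms cluster exponentially at rate `λ₁/λ₀`.

* `cluster_of_levels` (abstract): for a compact self-adjoint operator `A` on a complex Hilbert space, a subspace
  `D₀` invariant under `A` on which `A` is positive, the min–max levels `ℓ₀, ℓ₁` of `A` taken over `D₀` (level 0: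
  `sup` of the Rayleigh quotient; level 1: `inf` over one constraint vector in `D₀`) control the matrix elements of
  the powers on the closure `V = D̄₀`: there is a unit vector `Ω ∈ V` with
  `‖⟪x, Aⁿ g⟫ − ℓ₀ⁿ ⟪Ω, g⟫⟪x, Ω⟫‖ ≤ ℓ₁ⁿ ‖x‖ ‖g‖` for all `x, g ∈ D₀` — assembled from the landed Literature facts
  `exists_restrict_invariant` (restriction to `V`), `exists_top_eigenvector_of_dense` (top eigenvector, level 0),
  `norm_apply_le_secondLevel_of_dense` (`‖A w‖ ≤ ℓ₁‖w‖` on `Ω^⊥`, level 1) and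
  `norm_inner_pow_apply_sub_le_of_gap_rclike` (geometric decay of the powers).
* `transfer_cluster` (the registered sub-goal): for `β ≥ 0` and all `m_f > −1` there is a vacuum-overlap
  functional `c` on waves such that for all core waves `Φ, Ψ` and every `n`,
  `‖𝔫(Φ, 𝒮ⁿΨ) − λ₀ⁿ c(Ψ) conj(c(Φ))‖ ≤ λ₁ⁿ √(Re 𝔫(Φ,Φ)) √(Re 𝔫(Ψ,Ψ))`, where `𝔫 = fermionWeightForm`,
  `𝒮Ψ(U) = ∫ K_β(U,U') T̂_F(U')Ψ(U') dU'` is one transfer step (`⟪fΦ, 𝕋ⁿ fΨ⟫ = 𝔫(Φ, 𝒮ⁿΨ)` in the `L²` realisation)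
  and `λᵢ = qcdTransferLevel N_f S β m i`: the operator realisation of the lead's architecture (`R = √T̂_F` by
  `fermionSliceOp_sqrt_exists`, the Hermitian-kernel operator `𝕋` on `L²(sliceHaar ⊗ count)` by
  `qcdTransferKernel_regular` + `exists_hermitianKernelOp`, the embedded core by `embed_package` /
  `transferOp_apply_embed` / `transferOp_pow_embed`, the level identification `qcdTransferLevel_eq_embedded_levels`).

References: M. Lüscher, Commun. Math. Phys. 54 (1977) 283 [Luscher1977, pp. 283–292]; J. Smit, *Introduction to
Quantum Fields on a Lattice* (2023) §6.5 (6.87) [Smit2023]; M. Reed, B. Simon, *Methods of Modern Mathematical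
Physics IV*, Thm XIII.1 [ReedSimonIV1978].  Pure theorem file (no definitions).
-/

noncomputable section

open MeasureTheory Matrix Literature.MathematicalPhysics.QuantumFieldTheory Literature.MathematicalPhysics.QuantumLattice
open Literature.Analysis.OperatorTheory
open scoped InnerProductSpace ComplexConjugate

namespace Summit.QuantumFields.QCD.Cruxes.RobustYangMillsHandover.PinTheInfimum

namespace TransferSpectralDecay

/-! ### Abstract assembly: min–max levels over an invariant positive subspace control the powers -/

section Abstract

variable {H : Type*} [NormedAddCommGroup H] [InnerProductSpace ℂ H] [CompleteSpace H]

omit [CompleteSpace H] in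
/-- The quadratic form `y ↦ Re ⟪y, A y⟫` of a bounded operator is non-negative on the closure of any set on which it
is non-negative. [folklore] -/
theorem re_inner_nonneg_of_mem_closure (A : H →L[ℂ] H) {s : Set H} (hs : ∀ f ∈ s, 0 ≤ RCLike.re ⟪f, A f⟫_ℂ)
    {y : H} (hy : y ∈ closure s) : 0 ≤ RCLike.re ⟪y, A y⟫_ℂ := by
  have hcont : Continuous fun y : H => RCLike.re ⟪y, A y⟫_ℂ :=
    RCLike.continuous_re.comp (continuous_id.inner A.continuous)
  exact closure_minimal (fun f hf => hs f hf) (isClosed_le continuous_const hcont) hy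

/-- **Min–max levels over an invariant positive subspace control the matrix elements of the powers.**  Let `A` be
a compact self-adjoint operator on a complex Hilbert space and `D₀` a non-zero subspace with `A D₀ ⊆ D₀` and
`Re ⟪f, A f⟫ ≥ 0` on `D₀`.  With `ℓ₀ = sup {Re⟪f,Af⟫/‖f‖² : f ∈ D₀ ∖ 0}` and
`ℓ₁ = inf_{φ ∈ D₀} sup {Re⟪f,Af⟫/‖f‖² : f ∈ D₀ ∖ 0, ⟪φ, f⟫ = 0}` there is a unit vector `Ω` in the closure `V` of
`D₀` such that `‖⟪x, Aⁿ g⟫ − ℓ₀ⁿ ⟪Ω, g⟫ ⟪x, Ω⟫‖ ≤ ℓ₁ⁿ ‖x‖ ‖g‖` for all `x, g ∈ D₀` and all `n` (and `ℓ₁ ≥ 0`;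
the same bound on `V` follows by continuity and is not needed here).
[cite: ReedSimonIV1978, Thm XIII.1] -/
theorem cluster_of_levels (A : H →L[ℂ] H) (hsa : IsSelfAdjoint A) (hcpt : IsCompactOperator A)
    (D₀ : Submodule ℂ H) (hinv : ∀ f ∈ D₀, A f ∈ D₀) (hpos : ∀ f ∈ D₀, 0 ≤ RCLike.re ⟪f, A f⟫_ℂ)
    (hne : ∃ f ∈ D₀, f ≠ 0) (ℓ₀ ℓ₁ : ℝ)
    (hℓ₀ : ℓ₀ = sSup ((fun f : H => RCLike.re ⟪f, A f⟫_ℂ / ‖f‖ ^ 2) '' {f | f ∈ D₀ ∧ f ≠ 0}))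
    (hℓ₁ : ℓ₁ = sInf ((fun φ : H => sSup ((fun f : H => RCLike.re ⟪f, A f⟫_ℂ / ‖f‖ ^ 2) ''
      {f | f ∈ D₀ ∧ f ≠ 0 ∧ ⟪φ, f⟫_ℂ = 0})) '' (D₀ : Set H))) :
    ∃ Ω : H, ‖Ω‖ = 1 ∧ 0 ≤ ℓ₁ ∧ ∀ (n : ℕ), ∀ x ∈ D₀, ∀ g ∈ D₀,
      ‖⟪x, (A ^ n) g⟫_ℂ - (ℓ₀ : ℂ) ^ n * ⟪Ω, g⟫_ℂ * ⟪x, Ω⟫_ℂ‖ ≤ ℓ₁ ^ n * ‖x‖ * ‖g‖ := by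
  -- the closure `V` of `D₀`: closed, complete, `A`-invariant, non-trivial
  set V : Submodule ℂ H := D₀.topologicalClosure with hVdef
  have hVc : IsClosed (V : Set H) := D₀.isClosed_topologicalClosure
  have hVcoe : (V : Set H) = closure (D₀ : Set H) := D₀.topologicalClosure_coe
  have hD₀V : ∀ f ∈ D₀, f ∈ V := fun f hf => D₀.le_topologicalClosure hf
  have hVinv : ∀ v ∈ V, A v ∈ V := by
    intro v hv
    have hv' : v ∈ closure (D₀ : Set H) := by rw [← hVcoe]; exact hv
    have h := map_mem_closure A.continuous hv' (fun y hy => hinv y hy)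
    show A v ∈ (V : Set H)
    rw [hVcoe]; exact h
  haveI : CompleteSpace V := hVc.completeSpace_coe
  obtain ⟨f₀, hf₀, hf₀0⟩ := hne
  haveI : Nontrivial V := by
    refine nontrivial_of_ne (⟨f₀, hD₀V f₀ hf₀⟩ : V) 0 ?_
    intro h
    exact hf₀0 (by simpa using congrArg Subtype.val h)
  -- symmetry of `A`
  have hsym : ∀ x y : H, ⟪A x, y⟫_ℂ = ⟪x, A y⟫_ℂ := fun x y => hsa.isSymmetric x y
  -- the restriction `T'` of `A` to `V`
  obtain ⟨T', hT'ap, hT'pow, -, hT'sym, hT'cpt⟩ := exists_restrict_invariant A V hVc hVinv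
  have hT'symm : ∀ v w : V, ⟪T' v, w⟫_ℂ = ⟪v, T' w⟫_ℂ := hT'sym hsym
  have hT'sa : IsSelfAdjoint T' := by
    rw [ContinuousLinearMap.isSelfAdjoint_iff_isSymmetric]
    exact fun v w => hT'symm v w
  have hT'c : IsCompactOperator T' := hT'cpt hcpt
  -- matrix elements of `T'` are those of `A`
  have hT'inner : ∀ v w : V, ⟪v, T' w⟫_ℂ = ⟪(v : H), A (w : H)⟫_ℂ := fun v w => by
    rw [Submodule.coe_inner, hT'ap]
  -- positivity on `V` (closure of positivity on `D₀`)
  have hposV : ∀ v : V, 0 ≤ RCLike.re ⟪v, T' v⟫_ℂ := by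
    intro v
    rw [hT'inner]
    have hv : (v : H) ∈ closure (D₀ : Set H) := by rw [← hVcoe]; exact v.2
    exact re_inner_nonneg_of_mem_closure A hpos hv
  -- the dense subspace `D = D₀ ∩ V` of `V`
  set D : Submodule ℂ V := D₀.comap V.subtype with hDdef
  have hmemD : ∀ v : V, v ∈ D ↔ (v : H) ∈ D₀ := fun v => Iff.rfl
  have hD : Dense (D : Set V) := by
    rw [Subtype.dense_iff]
    intro y hy
    have hy' : y ∈ closure (D₀ : Set H) := by rw [← hVcoe]; exact hy
    refine closure_mono ?_ hy'
    intro z hz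
    exact ⟨⟨z, hD₀V z hz⟩, (hmemD _).mpr hz, rfl⟩
  -- level 0: the top eigenvector
  obtain ⟨Ω, hΩ1, hTΩ, hle⟩ := exists_top_eigenvector_of_dense T' hT'sa hT'c hposV D hD
  set μ₀ : ℝ := sSup ((fun ψ : V => RCLike.re ⟪ψ, T' ψ⟫_ℂ / ‖ψ‖ ^ 2) '' {ψ | ψ ∈ D ∧ ψ ≠ 0}) with hμ₀
  -- level 1: the bound on `Ω^⊥`
  set μ₁ : ℝ := sInf ((fun φ : V => sSup ((fun ψ : V => RCLike.re ⟪ψ, T' ψ⟫_ℂ / ‖ψ‖ ^ 2) ''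
      {ψ | ψ ∈ D ∧ ψ ≠ 0 ∧ ⟪φ, ψ⟫_ℂ = 0})) '' (D : Set V)) with hμ₁
  have hgap : ∀ w : V, ⟪Ω, w⟫_ℂ = 0 → ‖T' w‖ ≤ μ₁ * ‖w‖ :=
    norm_apply_le_secondLevel_of_dense T' hT'sa hposV μ₀ hle Ω hΩ1 hTΩ D hD
  -- transport of the level sets from `V` to `H`
  have hval : ∀ ψ : V, RCLike.re ⟪ψ, T' ψ⟫_ℂ / ‖ψ‖ ^ 2 = RCLike.re ⟪(ψ : H), A ψ⟫_ℂ / ‖(ψ : H)‖ ^ 2 :=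
    fun ψ => by rw [hT'inner, Submodule.coe_norm]
  have hne0 : ∀ ψ : V, ψ ≠ 0 ↔ (ψ : H) ≠ 0 := fun ψ => by
    rw [Ne, Ne, ← Submodule.coe_eq_zero]
  have hset0 : (fun ψ : V => RCLike.re ⟪ψ, T' ψ⟫_ℂ / ‖ψ‖ ^ 2) '' {ψ | ψ ∈ D ∧ ψ ≠ 0} =
      (fun f : H => RCLike.re ⟪f, A f⟫_ℂ / ‖f‖ ^ 2) '' {f | f ∈ D₀ ∧ f ≠ 0} := by
    ext r
    constructor
    · rintro ⟨ψ, ⟨hψD, hψ0⟩, rfl⟩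
      exact ⟨(ψ : H), ⟨(hmemD ψ).mp hψD, (hne0 ψ).mp hψ0⟩, (hval ψ).symm⟩
    · rintro ⟨f, ⟨hfD, hf0⟩, rfl⟩
      refine ⟨⟨f, hD₀V f hfD⟩, ⟨(hmemD _).mpr hfD, (hne0 _).mpr hf0⟩, ?_⟩
      exact hval ⟨f, hD₀V f hfD⟩
  have hset1 : ∀ φ : V, (fun ψ : V => RCLike.re ⟪ψ, T' ψ⟫_ℂ / ‖ψ‖ ^ 2) ''
        {ψ | ψ ∈ D ∧ ψ ≠ 0 ∧ ⟪φ, ψ⟫_ℂ = 0} =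
      (fun f : H => RCLike.re ⟪f, A f⟫_ℂ / ‖f‖ ^ 2) '' {f | f ∈ D₀ ∧ f ≠ 0 ∧ ⟪(φ : H), f⟫_ℂ = 0} := by
    intro φ
    ext r
    constructor
    · rintro ⟨ψ, ⟨hψD, hψ0, hφψ⟩, rfl⟩
      refine ⟨(ψ : H), ⟨(hmemD ψ).mp hψD, (hne0 ψ).mp hψ0, ?_⟩, (hval ψ).symm⟩
      rwa [Submodule.coe_inner] at hφψ
    · rintro ⟨f, ⟨hfD, hf0, hφf⟩, rfl⟩
      refine ⟨⟨f, hD₀V f hfD⟩, ⟨(hmemD _).mpr hfD, (hne0 _).mpr hf0, ?_⟩, hval ⟨f, hD₀V f hfD⟩⟩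
      rw [Submodule.coe_inner]; exact hφf
  have hμ₀ℓ₀ : μ₀ = ℓ₀ := by rw [hμ₀, hℓ₀, hset0]
  have hμ₁ℓ₁ : μ₁ = ℓ₁ := by
    rw [hμ₁, hℓ₁]
    congr 1
    ext r
    constructor
    · rintro ⟨φ, hφD, rfl⟩
      refine ⟨(φ : H), (hmemD φ).mp hφD, ?_⟩
      show sSup _ = sSup _
      rw [hset1 φ]
    · rintro ⟨φ, hφD, rfl⟩
      refine ⟨⟨φ, hD₀V φ hφD⟩, (hmemD _).mpr hφD, ?_⟩
      show sSup _ = sSup _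
      rw [hset1]
  -- `ℓ₁ ≥ 0`
  have hℓ₁0 : 0 ≤ ℓ₁ := by
    rw [hℓ₁]
    refine Real.sInf_nonneg ?_
    rintro r ⟨φ, -, rfl⟩
    refine Real.sSup_nonneg ?_
    rintro q ⟨f, ⟨hfD, -, -⟩, rfl⟩
    exact div_nonneg (hpos f hfD) (sq_nonneg _)
  have hμ₁0 : 0 ≤ μ₁ := hμ₁ℓ₁ ▸ hℓ₁0
  -- geometric decay of the powers of `T'` on `V`
  have hdecay := fun n (x g : V) =>
    norm_inner_pow_apply_sub_le_of_gap_rclike T' hT'symm Ω hΩ1 (μ₀ : ℂ) hTΩ μ₁ hμ₁0 hgap n x g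
  refine ⟨(Ω : H), by rw [← Submodule.coe_norm]; exact hΩ1, hℓ₁0, fun n x hx g hg => ?_⟩
  have h := hdecay n ⟨x, hD₀V x hx⟩ ⟨g, hD₀V g hg⟩
  rw [Submodule.coe_inner, Submodule.coe_inner, Submodule.coe_inner, hT'pow, Submodule.coe_norm,
    Submodule.coe_norm, hμ₀ℓ₀, hμ₁ℓ₁] at h
  exact h

end Abstract

/-! ### The core of continuous gauge-invariant waves is a subspace -/

section Core

variable {Nf S : ℕ} [NeZero S]

/-- The zero wave lies in the form core. [folklore] -/
theorem zero_mem_transferCore : (0 : SliceWave Nf S) ∈ transferCore Nf S :=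
  ⟨continuous_const, fun g U => by simp [Matrix.mulVec_zero]⟩

/-- The form core is closed under addition. [folklore] -/
theorem add_mem_transferCore {Φ Ψ : SliceWave Nf S} (hΦ : Φ ∈ transferCore Nf S) (hΨ : Ψ ∈ transferCore Nf S) :
    Φ + Ψ ∈ transferCore Nf S :=
  ⟨hΦ.1.add hΨ.1, fun g U => by rw [Pi.add_apply, Pi.add_apply, hΦ.2 g U, hΨ.2 g U, Matrix.mulVec_add]⟩

/-- The form core is closed under scalar multiplication. [folklore] -/
theorem smul_mem_transferCore (c : ℂ) {Ψ : SliceWave Nf S} (hΨ : Ψ ∈ transferCore Nf S) :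
    c • Ψ ∈ transferCore Nf S :=
  ⟨hΨ.1.const_smul c, fun g U => by rw [Pi.smul_apply, Pi.smul_apply, hΨ.2 g U, Matrix.mulVec_smul]⟩

end Core

end TransferSpectralDecay

open TransferSpectralDecay TransferFormsEmbed EmbedPackage
open Summit.QuantumFields.QCD.Cruxes.StableActionBridge.Sketch (transferForm_self_nonneg isProbabilityMeasure_sliceHaar)
open Summit.QuantumFields.QCD.Cruxes.StableActionBridge.Sketch.TransferLevelBounds (fermionWeightForm_vacuum_ne_zero)

/-- **Exponential clustering of the QCD transfer matrix at the rate of its min–max gap** (registered sub-goal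
`transfer_cluster` of crux stmt-QuantumFields-8892, line `pin-the-infimum`).  For `β ≥ 0` and all bare masses
`m_f > −1` there is a vacuum-overlap functional `c` on the slice wave functions such that for all continuous
gauge-invariant waves `Φ, Ψ` (the form core of `QCDTransferMatrix.lean`) and every `n`,
`‖𝔫(Φ, 𝒮ⁿ Ψ) − λ₀ⁿ · c(Ψ) · conj (c Φ)‖ ≤ λ₁ⁿ · √(Re 𝔫(Φ,Φ)) · √(Re 𝔫(Ψ,Ψ))`,
where `𝔫 = fermionWeightForm` is the `T̂_F`-weighted pairing, `𝒮Ψ(U) = ∫ K_β(U,U') T̂_F(U') Ψ(U') dU'` one transfer step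
(so that `𝔫(Φ, 𝒮ⁿΨ) = ⟪T̂_F^{1/2}Φ, 𝕋ⁿ T̂_F^{1/2}Ψ⟫` for Smit's `𝕋 = T̂_F^{1/2} T̂_U T̂_F^{1/2}`), and
`λᵢ = qcdTransferLevel N_f S β m i` are the tree's min–max levels: the transfer-matrix correlations of lattice QCD on the
spatial torus of side `S` decay like `(λ₁/λ₀)ⁿ = e^{−n·qcdTransferGap}` relative to the vacuum term.  Proof: the `L²`
realisation of the lead's architecture (`R = √T̂_F`, the Hermitian-kernel operator on `L²(sliceHaar ⊗ count)`, the
embedded core and the level identification, all landed) fed into `cluster_of_levels`.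
[cite: Luscher1977, pp. 283–292] [cite: Smit2023, §6.5 (6.87)] [cite: ReedSimonIV1978, Thm XIII.1] -/
theorem transfer_cluster : ∀ (Nf S : ℕ) [NeZero S] (β : ℝ) (mq : Fin Nf → ℝ), 0 ≤ β → (∀ f, -1 < mq f) →
    ∃ c : SliceWave Nf S → ℂ, ∀ Φ ∈ transferCore Nf S, ∀ Ψ ∈ transferCore Nf S, ∀ n : ℕ,
      ‖fermionWeightForm mq Φ
            ((fun (Ψ' : SliceWave Nf S) (U : GaugeConfig 3 S (Matrix.specialUnitaryGroup (Fin 3) ℂ)) =>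
                ∫ U', (gaugeSliceKernel β U U' : ℂ) • (fermionSliceOp U' mq *ᵥ Ψ' U') ∂(sliceHaar S))^[n] Ψ) -
          (qcdTransferLevel Nf S β mq 0 : ℂ) ^ n * c Ψ * (starRingEnd ℂ) (c Φ)‖ ≤
        qcdTransferLevel Nf S β mq 1 ^ n * Real.sqrt ((fermionWeightForm mq Φ Φ).re) *
          Real.sqrt ((fermionWeightForm mq Ψ Ψ).re) := by
  intro Nf S _ β mq hβ hm
  haveI := isProbabilityMeasure_sliceHaar S
  -- the Fock index, linearly enumerated
  set J : Type := Fin (Fintype.card (Finset (SliceFermiIdx Nf S))) with hJ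
  set e : Finset (SliceFermiIdx Nf S) ≃ J := Fintype.equivFin _ with he
  -- `R = √T̂_F`: continuous, Hermitian, `R² = T̂_F`, covariant
  obtain ⟨R, hR, -, hRh, hRsq, hRcov⟩ := fermionSliceOp_sqrt_exists Nf S mq hm
  -- the scalar kernel `k((U,s),(U',t)) = K_β(U,U') (R(U)R(U'))_{st}` on `X × J` and its operator
  obtain ⟨hk, ⟨C, hC⟩, hherm⟩ := qcdTransferKernel_regular Nf S β J e R hR hRh
  set ν : Measure (GaugeConfig 3 S (Matrix.specialUnitaryGroup (Fin 3) ℂ) × J) :=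
    (sliceHaar S).prod (Measure.count : Measure J) with hν
  obtain ⟨A, hA, hsa, hcpt, -⟩ := exists_hermitianKernelOp ν
    (fun p q : GaugeConfig 3 S (Matrix.specialUnitaryGroup (Fin 3) ℂ) × J =>
      (gaugeSliceKernel β p.1 q.1 : ℂ) * (R p.1 * R q.1) (e.symm p.2) (e.symm q.2)) C hk hC hherm
  -- the embedded core `D₀ = {f | ∃ Ψ ∈ core, f = RΨ a.e.}` as a subspace of `L²(ν)`
  let D₀ : Submodule ℂ (Lp ℂ 2 ν) :=
    { carrier := {f | ∃ Ψ ∈ transferCore Nf S,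
        (f : GaugeConfig 3 S (Matrix.specialUnitaryGroup (Fin 3) ℂ) × J → ℂ) =ᵐ[ν]
          fun p => (R p.1 *ᵥ Ψ p.1) (e.symm p.2)}
      add_mem' := by
        rintro f g ⟨Φ, hΦ, hf⟩ ⟨Ψ, hΨ, hg⟩
        exact ⟨Φ + Ψ, add_mem_transferCore hΦ hΨ, embed_add J e R Φ Ψ f g hf hg⟩
      zero_mem' := by
        refine ⟨0, zero_mem_transferCore, ?_⟩
        filter_upwards [Lp.coeFn_zero ℂ 2 ν] with p hp
        rw [hp, Pi.zero_apply, Pi.zero_apply, Matrix.mulVec_zero, Pi.zero_apply]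
      smul_mem' := by
        rintro c f ⟨Ψ, hΨ, hf⟩
        exact ⟨c • Ψ, smul_mem_transferCore c hΨ, embed_smul J e R c Ψ f hf⟩ }
  have hmemD₀ : ∀ f : Lp ℂ 2 ν, f ∈ D₀ ↔ ∃ Ψ ∈ transferCore Nf S,
      (f : GaugeConfig 3 S (Matrix.specialUnitaryGroup (Fin 3) ℂ) × J → ℂ) =ᵐ[ν]
        fun p => (R p.1 *ᵥ Ψ p.1) (e.symm p.2) := fun f => Iff.rfl
  -- `A` maps the embedded core into itself (`𝕋 fΨ = f_{𝒮Ψ}`)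
  have hinv : ∀ f ∈ D₀, A f ∈ D₀ := by
    intro f hf
    obtain ⟨Ψ, hΨ, hfΨ⟩ := (hmemD₀ f).mp hf
    obtain ⟨hcont, hginv, hstep⟩ := transferOp_apply_embed Nf S β mq J e R hR hRh hRsq hRcov Ψ hΨ.1
    exact (hmemD₀ _).mpr ⟨_, ⟨hcont, hginv hΨ.2⟩, hstep f hfΨ A hA⟩
  -- positivity on the embedded core (`Re ⟪fΨ, 𝕋 fΨ⟫ = Re 𝔱(Ψ,Ψ) ≥ 0`)
  have hpos : ∀ f ∈ D₀, 0 ≤ RCLike.re ⟪f, A f⟫_ℂ := by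
    intro f hf
    obtain ⟨Ψ, hΨ, hfΨ⟩ := (hmemD₀ f).mp hf
    rw [inner_transferOp_embed_eq_transferForm Nf S β mq J e R hR hRh hRsq Ψ Ψ hΨ.1 hΨ.1 f f hfΨ hfΨ A hA,
      RCLike.re_to_complex]
    exact (transferForm_self_nonneg Nf S β mq hβ hm Ψ hΨ.1).1
  -- non-triviality: the embedded vacuum wave is non-zero
  have hne : ∃ f ∈ D₀, f ≠ 0 := by
    obtain ⟨f₀, hf₀⟩ := exists_embed J e hR
      (continuous_const : Continuous fun _ : GaugeConfig 3 S (Matrix.specialUnitaryGroup (Fin 3) ℂ) =>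
        (vacuum : Fock (SliceFermiIdx Nf S)))
    refine ⟨f₀, (hmemD₀ f₀).mpr ⟨_, vacuum_mem_transferCore, hf₀⟩, ?_⟩
    exact (EmbeddedLevels.embed_ne_zero_iff hR hRh hRsq continuous_const hf₀).mpr
      (fermionWeightForm_vacuum_ne_zero hm)
  -- identification of the levels with `qcdTransferLevel … 0 / 1`
  have hex : ∀ Ψ : SliceWave Nf S, Continuous Ψ → ∃ f : Lp ℂ 2 ν,
      (f : GaugeConfig 3 S (Matrix.specialUnitaryGroup (Fin 3) ℂ) × J → ℂ) =ᵐ[ν]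
        fun p => (R p.1 *ᵥ Ψ p.1) (e.symm p.2) := fun Ψ hΨ => exists_embed J e hR hΨ
  obtain ⟨hlev0, hlev1⟩ := qcdTransferLevel_eq_embedded_levels Nf S β mq J e R hR hRh hRsq hex A hA
  have hlev0' : qcdTransferLevel Nf S β mq 0 =
      sSup ((fun f : Lp ℂ 2 ν => RCLike.re ⟪f, A f⟫_ℂ / ‖f‖ ^ 2) '' {f | f ∈ D₀ ∧ f ≠ 0}) := hlev0
  have hlev1' : qcdTransferLevel Nf S β mq 1 =
      sInf ((fun φ : Lp ℂ 2 ν => sSup ((fun f : Lp ℂ 2 ν => RCLike.re ⟪f, A f⟫_ℂ / ‖f‖ ^ 2) ''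
        {f | f ∈ D₀ ∧ f ≠ 0 ∧ ⟪φ, f⟫_ℂ = 0})) '' (D₀ : Set (Lp ℂ 2 ν))) := hlev1
  -- the abstract clustering theorem
  obtain ⟨Ω, -, -, hdecay⟩ :=
    cluster_of_levels A hsa hcpt D₀ hinv hpos hne _ _ hlev0' hlev1'
  -- the vacuum-overlap functional
  classical
  refine ⟨fun Ψ => if h : Continuous Ψ then ⟪Ω, (hex Ψ h).choose⟫_ℂ else 0, ?_⟩
  intro Φ hΦ Ψ hΨ n
  set f : Lp ℂ 2 ν := (hex Φ hΦ.1).choose with hfdef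
  have hf : (f : GaugeConfig 3 S (Matrix.specialUnitaryGroup (Fin 3) ℂ) × J → ℂ) =ᵐ[ν]
      fun p => (R p.1 *ᵥ Φ p.1) (e.symm p.2) := (hex Φ hΦ.1).choose_spec
  set g : Lp ℂ 2 ν := (hex Ψ hΨ.1).choose with hgdef
  have hg : (g : GaugeConfig 3 S (Matrix.specialUnitaryGroup (Fin 3) ℂ) × J → ℂ) =ᵐ[ν]
      fun p => (R p.1 *ᵥ Ψ p.1) (e.symm p.2) := (hex Ψ hΨ.1).choose_spec
  simp only [dif_pos hΨ.1, dif_pos hΦ.1]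
  rw [← hgdef, ← hfdef]
  have hfD : f ∈ D₀ := (hmemD₀ f).mpr ⟨Φ, hΦ, hf⟩
  have hgD : g ∈ D₀ := (hmemD₀ g).mpr ⟨Ψ, hΨ, hg⟩
  have h := hdecay n f hfD g hgD
  -- `⟪f, Aⁿ g⟫ = 𝔫(Φ, 𝒮ⁿ Ψ)`
  obtain ⟨hcore, hpow⟩ := transferOp_pow_embed Nf S β mq J e R hR hRh hRsq hRcov A hA Ψ hΨ n
  have hinner : ⟪f, (A ^ n) g⟫_ℂ = fermionWeightForm mq Φ
      ((fun (Ψ' : SliceWave Nf S) (U : GaugeConfig 3 S (Matrix.specialUnitaryGroup (Fin 3) ℂ)) =>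
        ∫ U', (gaugeSliceKernel β U U' : ℂ) • (fermionSliceOp U' mq *ᵥ Ψ' U') ∂(sliceHaar S))^[n] Ψ) :=
    inner_embed_eq_fermionWeightForm Nf S mq J e R hR hRh hRsq Φ _ hΦ.1 hcore.1 f ((A ^ n) g) hf (hpow g hg)
  -- norms of the embedded waves
  have hnf : ‖f‖ = Real.sqrt ((fermionWeightForm mq Φ Φ).re) := by
    rw [← EmbeddedLevels.norm_sq_embed hR hRh hRsq hΦ.1 hf, Real.sqrt_sq (norm_nonneg _)]
  have hng : ‖g‖ = Real.sqrt ((fermionWeightForm mq Ψ Ψ).re) := by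
    rw [← EmbeddedLevels.norm_sq_embed hR hRh hRsq hΨ.1 hg, Real.sqrt_sq (norm_nonneg _)]
  rw [hinner, hnf, hng, ← inner_conj_symm f Ω] at h
  exact h

end Summit.QuantumFields.QCD.Cruxes.RobustYangMillsHandover.PinTheInfimum

end
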